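import Summits.Langlands.Langlands.Theses.PicardMuOrdinary
import Literature.NumberTheory.Automorphic.UnitaryGroupAutomorphicRep

/-!
# `IrregularClassicality` (stmt-Langlands-13758) — Negative knowledge V: the twisted-unitary
# interface at conjugation-fixed places, and the inert supersingular factor of a Picard curve

From the standing disprover's `Cruxes/IrregularClassicality/Disproof.lean`, cdisprove cycle 3
(2026-08-16), §12.  The crux is NOT refuted (it is the target weakened by a hypothesis); this file
lands the kernel-checkable part of the cycle-3 analysis of the registered line
`Cruxes/IrregularClassicality/Lines/sen-kills-cousin-on-p2.lean`, whose Stub T / Stub B replace the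
typed `GL₃` tower by a `χ`-twisted tower on Mok's unitary group `U_{K/ℚ}(3)`:

* `twistedUnitaryTower_isBaseChangeParam_of_fixed`, `twistedUnitaryTower_baseChangeSatake_of_fixed`:
  at a place `w` FIXED by the conjugation `c` (for `K = ℚ(ω)`: the inert primes and `λ`) the
  Literature predicate `UnitaryGroup.IsBaseChangeParam` pins the torus parameter of a
  `U_{E/F}(3)`-representation to `(b, 1, b⁻¹)`, so its base-change Satake multiset contains `1` and
  sums to `b + 1 + b⁻¹`; the stubs' congruence at an inert `𝔭 ∉ S` therefore reads
  `χ((p))·(b + 1 + b⁻¹) ≡ e₀(a_𝔭 f) (mod 3^k)`.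
* `picard_inert_root_neg_p_of_closure_of_det`, `picard_inert_det_fromBlocks_three`: the two algebraic
  shadows of the INERT SUPERSINGULAR FACTOR — at an inert good prime `𝔭 = (p)`, `Frob_p` swaps the
  two `ω`-eigenparts of `H¹(C)`, so `det(Frob_𝔭 | V_e) = -det(Frob_p | H¹) = -p³` (block
  anti-diagonal determinant with `3 × 3` blocks), and a cubic whose roots are closed under
  `γ ↦ p²/γ` (Weil duality) with constant term `-(-p³)` has the root `-p`:
  `P_e(T) = (T + p)(T² - (a_𝔭 + p)T + p²)` for EVERY Picard curve (numerically certified on 62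
  cases in the disprover's evidence file `inert_factor_evidence.txt`).  Consequence recorded for the
  lead: the twisting character of the line is pinned at inert primes, `χ((p)) = -p`.
* `eichlerShimuraTypic_three_dvd`: the conclusion shape of Stub N (`Fin n ≃ Fin 3 × Fin m`) forces
  `3 ∣ n`.

Mathlib + the route file + `Literature/NumberTheory/Automorphic/UnitaryGroupAutomorphicRep` only.
No statement here asserts a Theses decl. [folklore]
-/

set_option linter.dupNamespace false

namespace Summit.Langlands.Langlands.Theorems.IrregularClassicality.Negative

open Literature.NumberTheory.Automorphic Literature.NumberTheory.Automorphic.UnitaryGroup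
open NumberField IsDedekindDomain Polynomial

open scoped Classical

/-- **Base-change torus parameters at a `c`-fixed place, `N = 3`.**  The Literature predicate
`UnitaryGroup.IsBaseChangeParam` forces `(β₀, β₁, β₂) = (b, 1, b⁻¹)` with `b ≠ 0` when `c • w = w`
(Mínguez: the standard base change of the unramified representation of `U(J₃)(F_v)` with torus
parameter `b` at an inert `v` has Satake parameter `{b, 1, b⁻¹}`). [folklore] -/
theorem twistedUnitaryTower_isBaseChangeParam_of_fixed {F E : Type} [Field F] [NumberField F]
    [Field E] [NumberField E] [Algebra F E] {c : E ≃ₐ[F] E} {w : HeightOneSpectrum (𝓞 E)}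
    {β : Fin 3 → ℂ} (h : IsBaseChangeParam F E c 3 w β) (hw : c • w = w) :
    β 0 ≠ 0 ∧ β 1 = 1 ∧ β 2 = (β 0)⁻¹ := by
  obtain ⟨h0, h1⟩ := h
  have h1' := h1 hw
  refine ⟨h0 0, (h1' 1).2 rfl, ?_⟩
  have h02 : (0 : Fin 3).rev = 2 := rfl
  have := (h1' 0).1
  rwa [h02] at this

/-- **The base-change Satake multiset of a `U_{E/F}(3)`-representation at a `c`-fixed place
contains `1` and sums to `b + 1 + b⁻¹`.**  For the route (`F = ℚ`, `E = ℚ(ω)`): at every inert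
prime and at `λ`, Stub T / Stub B of `Lines/sen-kills-cousin-on-p2.lean` pin
`χ(ϖ_𝔭)·(b + 1 + b⁻¹) ≡ e₀(a_𝔭 f) (mod 3^k)`. [folklore] -/
theorem twistedUnitaryTower_baseChangeSatake_of_fixed {F E : Type} [Field F] [NumberField F]
    [Field E] [NumberField E] [Algebra F E] {c : E ≃ₐ[F] E}
    {hcpt : isCompact_glFiniteIntegralLevel 3 E}
    {π : AutomorphicRepData (quasiSplitDatum F E c 3 hcpt)} {w : HeightOneSpectrum (𝓞 E)}
    {α : Multiset ℂ} (h : HasBaseChangeSatakeAt F E c 3 hcpt π w α) (hw : c • w = w) :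
    ∃ b : ℂ, b ≠ 0 ∧ (1 : ℂ) ∈ α ∧ b ∈ α ∧ b⁻¹ ∈ α ∧ Multiset.card α = 3 ∧
      α.sum = b + 1 + b⁻¹ := by
  obtain ⟨𝔫, β, -, -, -, hβ, rfl, -⟩ := h
  obtain ⟨h0, h1, h2⟩ := twistedUnitaryTower_isBaseChangeParam_of_fixed hβ hw
  refine ⟨β 0, h0, ?_, ?_, ?_, by simp, ?_⟩
  · exact Multiset.mem_map.2 ⟨1, Finset.mem_univ_val 1, h1⟩
  · exact Multiset.mem_map.2 ⟨0, Finset.mem_univ_val 0, rfl⟩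
  · exact Multiset.mem_map.2 ⟨2, Finset.mem_univ_val 2, h2⟩
  · rw [← Finset.sum_eq_multiset_sum, Fin.sum_univ_three, h1, h2]

/-- **Inert supersingular factor, algebraic shadow.**  If a cubic `X³ - aX² + eX - d` over a
field has root multiset closed under `γ ↦ p²/γ` — on the elementary symmetric functions this gives
`e·d = a·p⁴` (and `d² = p⁶`) — and `d = -p³`, then `-p` is a root and the cubic factors as
`(X + p)(X² - (a + p)X + p²)`.  Applied to `P_e(T) = charpoly(Frob_𝔭 | V_e)` at an inert good prime
`𝔭 = (p)` of a Picard curve (closure from Weil duality `V_ē ≅ V_e^∨(-1)`, determinant from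
`picard_inert_det_fromBlocks_three`): `-p` is an eigenvalue of `Frob_𝔭` on `V_e`, i.e.
`T² + p ∣ L_{C/𝔽_p}(T)` and `tr(Frob_𝔭² | V_e) = a_𝔭(a_𝔭 + 2p)`. [folklore] -/
theorem picard_inert_root_neg_p_of_closure_of_det {L : Type*} [Field L] {p a e d : L} (hp : p ≠ 0)
    (hed : e * d = a * p ^ 4) (hd : d = -p ^ 3) :
    (X ^ 3 - C a * X ^ 2 + C e * X - C d).IsRoot (-p) ∧
      X ^ 3 - C a * X ^ 2 + C e * X - C d = (X + C p) * (X ^ 2 - C (a + p) * X + C (p ^ 2)) := by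
  have he : e = -p * a := by
    subst hd
    have hp3 : p ^ 3 ≠ 0 := pow_ne_zero 3 hp
    have : e * p ^ 3 = -(a * p) * p ^ 3 := by linear_combination -hed
    have := mul_right_cancel₀ hp3 this
    linear_combination this
  subst hd; subst he
  constructor
  · simp only [IsRoot.def, eval_sub, eval_add, eval_mul, eval_pow, eval_X, eval_C]
    ring
  · simp only [map_add, map_pow, map_neg, map_mul]
    ring

/-- **Inert supersingular factor, linear-algebra shadow: block anti-diagonal determinant with
`3 × 3` blocks.**  Over a commutative ring, `det (0 A; B 0) = -(det A · det B)` (sign `(-1)³`).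
At an inert prime the `𝔽_p`-Frobenius of a Picard curve swaps the two `ω`-eigenparts of `H¹`,
`Frob_p = (0 A; B 0)`, so `det(Frob_𝔭 | V_e) = det(AB) = -det(Frob_p | H¹) = -p³`. [folklore] -/
theorem picard_inert_det_fromBlocks_three {R : Type*} [CommRing R] (A B : Matrix (Fin 3) (Fin 3) R) :
    (Matrix.fromBlocks 0 A B 0).det = -(A.det * B.det) := by
  have hswap : (Matrix.fromBlocks (0 : Matrix (Fin 3) (Fin 3) R) A B 0) =
      (Matrix.fromBlocks A 0 0 B) * (Matrix.fromBlocks 0 1 1 0) := by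
    simp [Matrix.fromBlocks_multiply]
  have hperm : (Matrix.fromBlocks (0 : Matrix (Fin 3) (Fin 3) R) 1 1 0) =
      (Equiv.sumComm (Fin 3) (Fin 3)).toPEquiv.toMatrix := by
    ext i j
    rcases i with i | i <;> rcases j with j | j <;>
      simp [Matrix.fromBlocks, PEquiv.toMatrix, Equiv.toPEquiv, Matrix.one_apply, eq_comm]
  have hsign : Equiv.Perm.sign (Equiv.sumComm (Fin 3) (Fin 3)) = -1 := by decide
  rw [hswap, Matrix.det_mul, Matrix.det_fromBlocks_zero₂₁, hperm, Matrix.det_permutation, hsign]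
  simp

/-- **Stub N (`stub_eichlerShimuraTypic`) — its conclusion shape forces `3 ∣ n`.**  So at `n`
prime to `3` the stub asserts non-existence of any continuous `s : Γ_K → GL_n(ℚ̄₃)` satisfying the
Eichler–Shimura relation w.r.t. `ρ` off a finite set (true on paper under its big-image
hypotheses; not refutable in the tree, no such `ρ` being constructible). [folklore] -/
theorem eichlerShimuraTypic_three_dvd {n m : ℕ} (e : Fin n ≃ Fin 3 × Fin m) : 3 ∣ n :=
  ⟨m, by simpa using Fintype.card_congr e⟩

end Summit.Langlands.Langlands.Theorems.IrregularClassicality.Negative
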